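import Mathlib.Analysis.Calculus.ContDiff.Convolution
import Mathlib.Analysis.Calculus.BumpFunction.Convolution
import Mathlib.Analysis.Calculus.BumpFunction.FiniteDimension
import Mathlib.MeasureTheory.Integral.Bochner.ContinuousLinearMap
import Mathlib.MeasureTheory.Integral.DominatedConvergence
import Literature.Analysis.FluidPDE.CarlemanFirstWeight
import Literature.Analysis.FluidPDE.CarlemanSecond
import HarnessLib

/-!
# Carleman inequalities pass from `C_c^∞` to `C_c²` data (mollification)

Analysis/FluidPDE support file in the backward-uniqueness track of the decomposition of **ns.S08**
`Literature.Analysis.FluidPDE.ess_endpoint`. The two Carleman inequalities of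
Escauriaza–Seregin–Šverák (`Carleman.carleman_inequality_first`,
`Carleman.carleman_inequality_second`) are proved for `u ∈ C_c^∞`; in the proofs of unique
continuation and backward uniqueness (Seregin 2014, Lemmas A.1–A.4) they are applied to
cut-offs of (rescaled) `C²` / `W^{2,1}_2` functions, "by density". This file supplies that
density step in the `C²` setting: an estimate of the shape
`∫ (w₁|u|² + w₂|∇u|²) ≤ C ∫ w₃|∂ₜu + Δu|²`, with weights continuous on an open set `O ⊆ ℝ × E`,
valid for all `u ∈ C_c^∞` supported in `O`, remains valid for all `u ∈ C_c²` supported in `O`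
(`Carleman.weightedIneq_of_smooth`). The tool is mollification by normed bump functions on
`ℝ × E` (`Carleman.mollify`): it is smooth and compactly supported near the support of `u`,
commutes with `∂ₜ`, `∂ₑ`, `Δ` for `C²` data (`Carleman.fderiv_mollify_apply`,
`Carleman.dt_add_lap_mollify`), is bounded by the sup of the data, and converges pointwise
(Mathlib's `ContDiffBump.convolution_tendsto_right_of_continuous`); dominated convergence then
passes to the limit in both sides.

All statements are proved.

## References

* G. Seregin, *Lecture notes on regularity theory for the Navier–Stokes equations*, World
  Scientific 2014, App. A.2–A.3 (application of Props. 1.2–1.3 to `W^{2,1}_2` cut-offs).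
* L. Hörmander, *The analysis of linear partial differential operators I*, §1.3
  (regularisation by convolution). [folklore]
-/

noncomputable section

open MeasureTheory Set Function Filter Topology ContinuousLinearMap
open scoped InnerProductSpace RealInnerProductSpace Convolution

namespace Literature.Analysis.FluidPDE

namespace Carleman

section Mollify

variable {E : Type*} [NormedAddCommGroup E] [InnerProductSpace ℝ E] [FiniteDimensional ℝ E]
  [MeasurableSpace E] [BorelSpace E]
variable {F : Type*} [NormedAddCommGroup F] [InnerProductSpace ℝ F]

/-- Lebesgue measure on `ℝ × E` is an additive Haar measure (needed by the convolution API;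
invoked with `haveI` inside the proofs, no global instance). [folklore] -/
theorem isAddHaarMeasure_volume_prod : (volume : Measure (ℝ × E)).IsAddHaarMeasure :=
  Measure.prod.instIsAddHaarMeasure _ _

/-- Mollification on space–time by a normed bump function: `(φ ⋆ u)(z) = ∫ φ(ζ) u(z - ζ) dζ`. [folklore] -/
def mollify (φ : ContDiffBump (0 : ℝ × E)) (U : ℝ × E → F) : ℝ × E → F :=
  φ.normed volume ⋆[lsmul ℝ ℝ, volume] U

variable (φ : ContDiffBump (0 : ℝ × E))

/-- Unfolding. [folklore] -/
theorem mollify_apply (U : ℝ × E → F) (z : ℝ × E) :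
    mollify φ U z = ∫ ζ, φ.normed volume ζ • U (z - ζ) := by
  rw [mollify, convolution_def]
  rfl

/-- A mollified continuous function is smooth. [folklore] -/
theorem contDiff_mollify {U : ℝ × E → F} (hU : Continuous U) {n : ℕ∞} :
    ContDiff ℝ n (mollify φ U) := by
  haveI : (volume : Measure (ℝ × E)).IsAddHaarMeasure := isAddHaarMeasure_volume_prod
  exact (φ.hasCompactSupport_normed (μ := volume)).contDiff_convolution_left _ φ.contDiff_normed
    (hU.locallyIntegrable (μ := volume))

/-- A mollified compactly supported function is compactly supported. [folklore] -/
theorem hasCompactSupport_mollify {U : ℝ × E → F} (hUc : HasCompactSupport U) :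
    HasCompactSupport (mollify φ U) :=
  (φ.hasCompactSupport_normed (μ := volume)).convolution _ hUc

/-- The support of a mollification lies in the `r_out`-thickening of the support. [folklore] -/
theorem tsupport_mollify_subset (U : ℝ × E → F) :
    tsupport (mollify φ U) ⊆ Metric.cthickening φ.rOut (tsupport U) := by
  have h1 : support (mollify φ U) ⊆ Metric.thickening φ.rOut (tsupport U) := by
    refine (support_convolution_subset (L := lsmul ℝ ℝ) (μ := volume)).trans ?_
    rw [φ.support_normed_eq]
    intro z hz
    obtain ⟨a, ha, b, hb, rfl⟩ := hz
    rw [Metric.mem_thickening_iff]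
    refine ⟨b, subset_tsupport _ hb, ?_⟩
    rw [dist_eq_norm]
    simpa using ha
  exact (closure_mono h1).trans
    ((Metric.closure_thickening_subset_cthickening _ _).trans subset_rfl)

/-- **Derivatives commute with mollification** for `C¹` compactly supported data:
`D(φ ⋆ u)(z) v = (φ ⋆ (D u · v))(z)`. [folklore] -/
theorem fderiv_mollify_apply {U : ℝ × E → F} (hU : ContDiff ℝ 1 U) (hUc : HasCompactSupport U)
    (z v : ℝ × E) :
    fderiv ℝ (mollify φ U) z v = mollify φ (fun y => fderiv ℝ U y v) z := by
  haveI : (volume : Measure (ℝ × E)).IsAddHaarMeasure := isAddHaarMeasure_volume_prod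
  have hf : LocallyIntegrable (φ.normed volume) volume := φ.continuous_normed.locallyIntegrable
  have h := hUc.hasFDerivAt_convolution_right (L := lsmul ℝ ℝ) (μ := volume) hf hU z
  rw [mollify, h.fderiv, convolution_def, mollify, convolution_def, ContinuousLinearMap.integral_apply]
  · simp [lsmul_apply]
  · apply Continuous.integrable_of_hasCompactSupport
    · exact ((lsmul ℝ ℝ).precompR (ℝ × E)).continuous₂.comp
        (φ.continuous_normed.prodMk ((hU.continuous_fderiv one_ne_zero).comp
          (continuous_const.sub continuous_id)))
    · exact (φ.hasCompactSupport_normed (μ := volume)).mono fun t ht => by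
        contrapose! ht
        simp [notMem_support.1 ht]

/-- `∂ₜ(φ ⋆ u) = φ ⋆ ∂ₜu`. [folklore] -/
theorem dt_mollify {U : ℝ × E → F} (hU : ContDiff ℝ 1 U) (hUc : HasCompactSupport U) :
    dt (mollify φ U) = mollify φ (dt U) := by
  funext z
  rw [dt_apply, fderiv_mollify_apply φ hU hUc]
  rfl

/-- `∂ₑ(φ ⋆ u) = φ ⋆ ∂ₑu`. [folklore] -/
theorem dx_mollify {U : ℝ × E → F} (hU : ContDiff ℝ 1 U) (hUc : HasCompactSupport U) (e : E) :
    dx e (mollify φ U) = mollify φ (dx e U) := by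
  funext z
  rw [dx_apply, fderiv_mollify_apply φ hU hUc]
  rfl

omit [FiniteDimensional ℝ E] [MeasurableSpace E] [BorelSpace E] in
/-- Directional derivatives of `C^{n+1}` functions are `C^n`. [folklore] -/
theorem contDiff_fderiv_apply_const_of_succ {U : ℝ × E → F} {n : ℕ} (hU : ContDiff ℝ (n + 1 : ℕ) U)
    (w : ℝ × E) : ContDiff ℝ n fun z => fderiv ℝ U z w :=
  (hU.fderiv_right (m := n) (by norm_cast)).clm_apply contDiff_const

/-- Mollification is additive on continuous compactly supported data. [folklore] -/
theorem mollify_add {U V : ℝ × E → F} (hU : Continuous U) (hV : Continuous V) (z : ℝ × E) :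
    mollify φ (fun y => U y + V y) z = mollify φ U z + mollify φ V z := by
  simp only [mollify_apply, smul_add]
  apply integral_add
  · exact (φ.continuous_normed.smul (hU.comp (continuous_const.sub continuous_id))).integrable_of_hasCompactSupport
      ((φ.hasCompactSupport_normed (μ := volume)).mono fun t ht => by
        contrapose! ht; simp [notMem_support.1 ht])
  · exact (φ.continuous_normed.smul (hV.comp (continuous_const.sub continuous_id))).integrable_of_hasCompactSupport
      ((φ.hasCompactSupport_normed (μ := volume)).mono fun t ht => by
        contrapose! ht; simp [notMem_support.1 ht])

/-- Mollification commutes with finite sums of continuous data. [folklore] -/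
theorem mollify_finset_sum {ι : Type*} (s : Finset ι) {U : ι → ℝ × E → F}
    (hU : ∀ i, Continuous (U i)) (z : ℝ × E) :
    mollify φ (fun y => ∑ i ∈ s, U i y) z = ∑ i ∈ s, mollify φ (U i) z := by
  classical
  induction s using Finset.induction_on with
  | empty => simp [mollify_apply]
  | insert a s ha ih =>
    simp only [Finset.sum_insert ha]
    rw [← ih, ← mollify_add φ (hU a) (continuous_finsetSum _ fun i _ => hU i)]

/-- **`(∂ₜ + Δ)(φ ⋆ u) = φ ⋆ (∂ₜu + Δu)`** for `u ∈ C_c²`. [folklore] -/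
theorem dt_add_lap_mollify {U : ℝ × E → F} (hU : ContDiff ℝ 2 U) (hUc : HasCompactSupport U)
    (z : ℝ × E) :
    dt (mollify φ U) z + lap (mollify φ U) z = mollify φ (fun y => dt U y + lap U y) z := by
  have hU1 : ContDiff ℝ 1 U := hU.of_le (by norm_cast)
  have hdx1 : ∀ e : E, ContDiff ℝ 1 (dx e U) := fun e =>
    contDiff_fderiv_apply_const_of_succ (n := 1) hU (0, e)
  have hdxc : ∀ e : E, HasCompactSupport (dx e U) := fun e => hasCompactSupport_dx hUc e
  have cdt : Continuous (dt U) := (contDiff_fderiv_apply_const_of_succ (n := 1) hU (1, 0)).continuous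
  have cdxdx : ∀ e : E, Continuous (dx e (dx e U)) := fun e =>
    (contDiff_fderiv_apply_const_of_succ (n := 0) (hdx1 e) (0, e)).continuous
  have clap : Continuous (lap U) := by
    unfold lap
    exact continuous_finsetSum _ fun i _ => cdxdx _
  have hlap : lap (mollify φ U) z = mollify φ (lap U) z := by
    have step : ∀ i, dx (stdOrthonormalBasis ℝ E i) (dx (stdOrthonormalBasis ℝ E i) (mollify φ U)) z =
        mollify φ (dx (stdOrthonormalBasis ℝ E i) (dx (stdOrthonormalBasis ℝ E i) U)) z := by
      intro i
      rw [dx_mollify φ hU1 hUc, dx_mollify φ (hdx1 _) (hdxc _)]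
    show ∑ i, dx (stdOrthonormalBasis ℝ E i) (dx (stdOrthonormalBasis ℝ E i) (mollify φ U)) z = _
    rw [Finset.sum_congr rfl fun i _ => step i,
      ← mollify_finset_sum φ Finset.univ fun i => cdxdx (stdOrthonormalBasis ℝ E i)]
    rfl
  rw [dt_mollify φ hU1 hUc, hlap, ← mollify_add φ cdt clap]

/-- **Sup bound**: `‖(φ ⋆ g)(z)‖ ≤ B` if `‖g‖ ≤ B` everywhere (`φ ≥ 0`, `∫ φ = 1`). [folklore] -/
theorem norm_mollify_le {g : ℝ × E → F} {B : ℝ} (hB : ∀ y, ‖g y‖ ≤ B)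
    (z : ℝ × E) : ‖mollify φ g z‖ ≤ B := by
  haveI : (volume : Measure (ℝ × E)).IsAddHaarMeasure := isAddHaarMeasure_volume_prod
  have hB0 : 0 ≤ B := (norm_nonneg _).trans (hB 0)
  rw [mollify_apply]
  calc ‖∫ ζ, φ.normed volume ζ • g (z - ζ)‖
      ≤ ∫ ζ, ‖φ.normed volume ζ • g (z - ζ)‖ := norm_integral_le_integral_norm _
    _ ≤ ∫ ζ, φ.normed volume ζ * B := by
        apply integral_mono_of_nonneg (Eventually.of_forall fun _ => norm_nonneg _)
          ((φ.integrable_normed (μ := volume)).mul_const B) (Eventually.of_forall fun ζ => ?_)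
        show ‖φ.normed volume ζ • g (z - ζ)‖ ≤ φ.normed volume ζ * B
        rw [norm_smul, Real.norm_eq_abs, abs_of_nonneg (φ.nonneg_normed _)]
        exact mul_le_mul_of_nonneg_left (hB _) (φ.nonneg_normed _)
    _ = B := by rw [integral_mul_const, φ.integral_normed, one_mul]

/-! ### The density theorem -/

omit [InnerProductSpace ℝ F] in
/-- `r/(k+2) → 0`. [folklore] -/
theorem tendsto_div_nat_add_two (r : ℝ) : Tendsto (fun k : ℕ => r / ((k : ℝ) + 2)) atTop (𝓝 0) :=
  tendsto_const_nhds.div_atTop (tendsto_atTop_add_const_right _ _ tendsto_natCast_atTop_atTop)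

/-- **Weighted Carleman-type inequalities pass from `C_c^∞` to `C_c²` data.** Let `O ⊆ ℝ × E`
be open, `w₁, w₂, w₃` continuous on `O`, and suppose that
`∫ (w₁|v|² + w₂|∇v|²) ≤ C ∫ w₃|∂ₜv + Δv|²` for every smooth `v` with compact support in `O`.
Then the same inequality holds for every `u ∈ C²` with compact support in `O`
(mollify, apply, and pass to the limit by dominated convergence: the mollifications and their
first/second derivatives are supported in a fixed compact subset of `O`, bounded by the sups of
the corresponding derivatives of `u`, and converge pointwise). [folklore] -/
theorem weightedIneq_of_smooth [CompleteSpace F] {O : Set (ℝ × E)} (hO : IsOpen O)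
    {w₁ w₂ w₃ : ℝ × E → ℝ} (hw₁ : ContinuousOn w₁ O) (hw₂ : ContinuousOn w₂ O)
    (hw₃ : ContinuousOn w₃ O) {C : ℝ}
    (H : ∀ V : ℝ × E → F, ContDiff ℝ (⊤ : ℕ∞) V → HasCompactSupport V → tsupport V ⊆ O →
      ∫ z, (w₁ z * ‖V z‖ ^ 2 + w₂ z * gradSq V z) ≤ C * ∫ z, w₃ z * ‖dt V z + lap V z‖ ^ 2)
    {U : ℝ × E → F} (hU : ContDiff ℝ 2 U) (hUc : HasCompactSupport U) (hUO : tsupport U ⊆ O) :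
    ∫ z, (w₁ z * ‖U z‖ ^ 2 + w₂ z * gradSq U z) ≤ C * ∫ z, w₃ z * ‖dt U z + lap U z‖ ^ 2 := by
  haveI : (volume : Measure (ℝ × E)).IsAddHaarMeasure := isAddHaarMeasure_volume_prod
  set b := stdOrthonormalBasis ℝ E with hb
  -- ## room around the support, the bumps, the mollifications
  obtain ⟨r, hr, hrO⟩ := hUc.isCompact.exists_cthickening_subset_open hO hUO
  set K' : Set (ℝ × E) := Metric.cthickening r (tsupport U) with hK'
  have hK'c : IsCompact K' := hUc.isCompact.cthickening
  have hK'O : K' ⊆ O := hrO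
  have hK'm : MeasurableSet K' := Metric.isClosed_cthickening.measurableSet
  have hKK' : tsupport U ⊆ K' := Metric.self_subset_cthickening _
  have hrk : ∀ k : ℕ, (0 : ℝ) < r / (2 * ((k : ℝ) + 2)) ∧ r / (2 * ((k : ℝ) + 2)) < r / ((k : ℝ) + 2) := by
    intro k
    have hk : (0 : ℝ) < (k : ℝ) + 2 := by positivity
    refine ⟨by positivity, ?_⟩
    rw [div_lt_div_iff₀ (by positivity) hk]
    nlinarith
  let φ : ℕ → ContDiffBump (0 : ℝ × E) := fun k =>
    ⟨r / (2 * ((k : ℝ) + 2)), r / ((k : ℝ) + 2), (hrk k).1, (hrk k).2⟩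
  have hφr : ∀ k, (φ k).rOut = r / ((k : ℝ) + 2) := fun k => rfl
  have hφle : ∀ k, (φ k).rOut ≤ r := fun k => by
    rw [hφr, div_le_iff₀ (by positivity)]
    nlinarith [hr.le, (Nat.cast_nonneg k : (0 : ℝ) ≤ k)]
  have hφ0 : Tendsto (fun k => (φ k).rOut) atTop (𝓝 0) := by
    simp only [hφr]; exact tendsto_div_nat_add_two r
  set Uk : ℕ → ℝ × E → F := fun k => mollify (φ k) U with hUk
  have hU1 : ContDiff ℝ 1 U := hU.of_le (by norm_cast)
  have cU : Continuous U := hU.continuous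
  have hdx1 : ∀ e : E, ContDiff ℝ 1 (dx e U) := fun e => contDiff_fderiv_apply_const_of_succ (n := 1) hU (0, e)
  have cdx : ∀ e : E, Continuous (dx e U) := fun e => (hdx1 e).continuous
  have cdt : Continuous (dt U) := (contDiff_fderiv_apply_const_of_succ (n := 1) hU (1, 0)).continuous
  have cdxdx : ∀ e : E, Continuous (dx e (dx e U)) := fun e =>
    (contDiff_fderiv_apply_const_of_succ (n := 0) (hdx1 e) (0, e)).continuous
  have clap : Continuous (lap U) := by
    unfold lap; exact continuous_finsetSum _ fun i _ => cdxdx _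
  have cPL : Continuous fun y => dt U y + lap U y := cdt.add clap
  have hks : ∀ k, ContDiff ℝ (⊤ : ℕ∞) (Uk k) := fun k => contDiff_mollify _ cU
  have hkc : ∀ k, HasCompactSupport (Uk k) := fun k => hasCompactSupport_mollify _ hUc
  have hkK : ∀ k, tsupport (Uk k) ⊆ K' := fun k =>
    (tsupport_mollify_subset _ U).trans (Metric.cthickening_mono (hφle k) _)
  have hkO : ∀ k, tsupport (Uk k) ⊆ O := fun k => (hkK k).trans hK'O
  have Hk : ∀ k, ∫ z, (w₁ z * ‖Uk k z‖ ^ 2 + w₂ z * gradSq (Uk k) z) ≤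
      C * ∫ z, w₃ z * ‖dt (Uk k) z + lap (Uk k) z‖ ^ 2 := fun k => H _ (hks k) (hkc k) (hkO k)
  -- ## derivatives of the mollifications
  have hkdx : ∀ k i, dx (b i) (Uk k) = mollify (φ k) (dx (b i) U) := fun k i => dx_mollify _ hU1 hUc _
  have hkPL : ∀ k z, dt (Uk k) z + lap (Uk k) z = mollify (φ k) (fun y => dt U y + lap U y) z :=
    fun k z => dt_add_lap_mollify _ hU hUc z
  -- ## pointwise convergence
  have limU : ∀ z, Tendsto (fun k => Uk k z) atTop (𝓝 (U z)) := fun z =>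
    ContDiffBump.convolution_tendsto_right_of_continuous hφ0 cU z
  have limdx : ∀ i z, Tendsto (fun k => dx (b i) (Uk k) z) atTop (𝓝 (dx (b i) U z)) := by
    intro i z
    simp only [hkdx]
    exact ContDiffBump.convolution_tendsto_right_of_continuous hφ0 (cdx _) z
  have limPL : ∀ z, Tendsto (fun k => dt (Uk k) z + lap (Uk k) z) atTop (𝓝 (dt U z + lap U z)) := by
    intro z
    simp only [hkPL]
    exact ContDiffBump.convolution_tendsto_right_of_continuous hφ0 cPL z
  -- ## uniform bounds
  obtain ⟨B₀, hB₀⟩ := cU.bounded_above_of_compact_support hUc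
  have hBi' : ∀ i, ∃ Bi, ∀ y, ‖dx (b i) U y‖ ≤ Bi := fun i =>
    (cdx _).bounded_above_of_compact_support (hasCompactSupport_dx hUc _)
  choose Bi hBi using hBi'
  have hPLc : HasCompactSupport fun y => dt U y + lap U y := by
    refine hUc.mono' fun z hz => ?_
    by_contra h
    apply hz
    show dt U z + lap U z = 0
    rw [dt_apply, fderiv_of_notMem_tsupport (𝕜 := ℝ) h,
      image_eq_zero_of_notMem_tsupport fun h' => h (tsupport_lap_subset _ h')]
    simp
  obtain ⟨B₃, hB₃⟩ := cPL.bounded_above_of_compact_support hPLc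
  have bU : ∀ k z, ‖Uk k z‖ ≤ B₀ := fun k z => norm_mollify_le _ hB₀ z
  have bdx : ∀ k i z, ‖dx (b i) (Uk k) z‖ ≤ Bi i := fun k i z => by
    rw [hkdx]; exact norm_mollify_le _ (hBi i) z
  have bPL : ∀ k z, ‖dt (Uk k) z + lap (Uk k) z‖ ≤ B₃ := fun k z => by
    rw [hkPL]; exact norm_mollify_le _ hB₃ z
  obtain ⟨M₁, hM₁⟩ := hK'c.exists_bound_of_continuousOn (hw₁.mono hK'O)
  obtain ⟨M₂, hM₂⟩ := hK'c.exists_bound_of_continuousOn (hw₂.mono hK'O)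
  obtain ⟨M₃, hM₃⟩ := hK'c.exists_bound_of_continuousOn (hw₃.mono hK'O)
  -- ## vanishing off `K'`
  have offU : ∀ z ∉ K', U z = 0 := fun z hz => image_eq_zero_of_notMem_tsupport fun h => hz (hKK' h)
  have offUk : ∀ k, ∀ z ∉ K', Uk k z = 0 := fun k z hz =>
    image_eq_zero_of_notMem_tsupport fun h => hz (hkK k h)
  have offG : ∀ z ∉ K', gradSq U z = 0 := fun z hz => by
    simp [gradSq, dx, fderiv_of_notMem_tsupport (𝕜 := ℝ) (fun h => hz (hKK' h))]
  have offGk : ∀ k, ∀ z ∉ K', gradSq (Uk k) z = 0 := fun k z hz => by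
    simp [gradSq, dx, fderiv_of_notMem_tsupport (𝕜 := ℝ) (fun h => hz (hkK k h))]
  have offPL : ∀ z ∉ K', dt U z + lap U z = 0 := fun z hz => by
    have h1 : z ∉ tsupport U := fun h => hz (hKK' h)
    rw [dt_apply, fderiv_of_notMem_tsupport (𝕜 := ℝ) h1,
      image_eq_zero_of_notMem_tsupport fun h => h1 (tsupport_lap_subset _ h)]
    simp
  have offPLk : ∀ k, ∀ z ∉ K', dt (Uk k) z + lap (Uk k) z = 0 := fun k z hz => by
    have h1 : z ∉ tsupport (Uk k) := fun h => hz (hkK k h)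
    rw [dt_apply, fderiv_of_notMem_tsupport (𝕜 := ℝ) h1,
      image_eq_zero_of_notMem_tsupport fun h => h1 (tsupport_lap_subset _ h)]
    simp
  -- ## continuity of the integrands (gluing across `∂O`)
  have cG : ∀ (w : ℝ × E → ℝ), ContinuousOn w O → ∀ V : ℝ × E → F, ContDiff ℝ 1 V →
      tsupport V ⊆ O → Continuous fun z => w z * gradSq V z := by
    intro w hw V hV hVO
    have e : (fun z => w z * gradSq V z) = fun z => ∑ i, w z * ‖dx (b i) V z‖ ^ 2 := by
      funext z; rw [gradSq, Finset.mul_sum]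
    rw [e]
    exact continuous_finsetSum _ fun i _ =>
      continuous_mul_norm_sq_of_tsupport_subset hO hw
        ((hV.continuous_fderiv one_ne_zero).clm_apply continuous_const)
        ((tsupport_dx_subset _ V).trans hVO)
  have hPLs : ∀ V : ℝ × E → F, tsupport (fun z => dt V z + lap V z) ⊆ tsupport V := by
    intro V
    refine closure_minimal (fun z hz => ?_) (isClosed_tsupport V)
    by_contra h
    apply hz
    show dt V z + lap V z = 0
    rw [dt_apply, fderiv_of_notMem_tsupport (𝕜 := ℝ) h,
      image_eq_zero_of_notMem_tsupport fun h' => h (tsupport_lap_subset _ h')]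
    simp
  set F₁ : ℕ → ℝ × E → ℝ := fun k z => w₁ z * ‖Uk k z‖ ^ 2 + w₂ z * gradSq (Uk k) z with hF₁
  set f₁ : ℝ × E → ℝ := fun z => w₁ z * ‖U z‖ ^ 2 + w₂ z * gradSq U z with hf₁
  set F₂ : ℕ → ℝ × E → ℝ := fun k z => w₃ z * ‖dt (Uk k) z + lap (Uk k) z‖ ^ 2 with hF₂
  set f₂ : ℝ × E → ℝ := fun z => w₃ z * ‖dt U z + lap U z‖ ^ 2 with hf₂
  have cF₁ : ∀ k, Continuous (F₁ k) := fun k =>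
    (continuous_mul_norm_sq_of_tsupport_subset hO hw₁ (hks k).continuous (hkO k)).add
      (cG w₂ hw₂ _ ((hks k).of_le (by exact_mod_cast le_top)) (hkO k))
  have cF₂ : ∀ k, Continuous (F₂ k) := fun k =>
    continuous_mul_norm_sq_of_tsupport_subset hO hw₃
      ((contDiff_dt (hks k)).continuous.add (contDiff_lap (hks k)).continuous)
      ((hPLs _).trans (hkO k))
  -- ## domination
  have hvol : volume K' < ⊤ := hK'c.measure_lt_top
  set R₁ : ℝ := |M₁| * B₀ ^ 2 + |M₂| * ∑ i, Bi i ^ 2 with hR₁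
  set R₂ : ℝ := |M₃| * B₃ ^ 2 with hR₂
  have ib₁ : Integrable (K'.indicator fun _ : ℝ × E => R₁) :=
    (integrableOn_const (hs := hvol.ne)).integrable_indicator hK'm
  have ib₂ : Integrable (K'.indicator fun _ : ℝ × E => R₂) :=
    (integrableOn_const (hs := hvol.ne)).integrable_indicator hK'm
  have hgradk : ∀ k z, gradSq (Uk k) z ≤ ∑ i, Bi i ^ 2 := fun k z =>
    Finset.sum_le_sum fun i _ => by
      have h := bdx k i z
      have h0 : 0 ≤ ‖dx (b i) (Uk k) z‖ := norm_nonneg _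
      nlinarith
  have hb₁ : ∀ k, ∀ᵐ z ∂volume, ‖F₁ k z‖ ≤ K'.indicator (fun _ => R₁) z := fun k =>
    Eventually.of_forall fun z => by
      by_cases hz : z ∈ K'
      · rw [indicator_of_mem hz, Real.norm_eq_abs, hF₁]
        have h1 : |w₁ z| ≤ |M₁| := (hM₁ z hz).trans (le_abs_self _)
        have h2 : |w₂ z| ≤ |M₂| := (hM₂ z hz).trans (le_abs_self _)
        have hU2 : ‖Uk k z‖ ^ 2 ≤ B₀ ^ 2 := by
          have := bU k z; have h0 := norm_nonneg (Uk k z); nlinarith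
        calc |w₁ z * ‖Uk k z‖ ^ 2 + w₂ z * gradSq (Uk k) z|
            ≤ |w₁ z| * ‖Uk k z‖ ^ 2 + |w₂ z| * gradSq (Uk k) z := by
              refine (abs_add_le _ _).trans ?_
              rw [abs_mul, abs_mul, abs_of_nonneg (sq_nonneg ‖Uk k z‖), abs_of_nonneg (gradSq_nonneg _ _)]
          _ ≤ |M₁| * B₀ ^ 2 + |M₂| * ∑ i, Bi i ^ 2 :=
              add_le_add (mul_le_mul h1 hU2 (sq_nonneg _) (abs_nonneg _))
                (mul_le_mul h2 (hgradk k z) (gradSq_nonneg _ _) (abs_nonneg _))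
      · rw [indicator_of_notMem hz, hF₁]
        simp [offUk k z hz, offGk k z hz]
  have hb₂ : ∀ k, ∀ᵐ z ∂volume, ‖F₂ k z‖ ≤ K'.indicator (fun _ => R₂) z := fun k =>
    Eventually.of_forall fun z => by
      by_cases hz : z ∈ K'
      · rw [indicator_of_mem hz, Real.norm_eq_abs, hF₂]
        have h3 : |w₃ z| ≤ |M₃| := (hM₃ z hz).trans (le_abs_self _)
        have hP2 : ‖dt (Uk k) z + lap (Uk k) z‖ ^ 2 ≤ B₃ ^ 2 := by
          have := bPL k z; have h0 := norm_nonneg (dt (Uk k) z + lap (Uk k) z); nlinarith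
        show |w₃ z * ‖dt (Uk k) z + lap (Uk k) z‖ ^ 2| ≤ R₂
        rw [abs_mul, abs_of_nonneg (sq_nonneg ‖dt (Uk k) z + lap (Uk k) z‖)]
        exact mul_le_mul h3 hP2 (sq_nonneg _) (abs_nonneg _)
      · rw [indicator_of_notMem hz, hF₂]
        show ‖w₃ z * ‖dt (Uk k) z + lap (Uk k) z‖ ^ 2‖ ≤ 0
        rw [offPLk k z hz]
        simp
  -- ## pointwise limits
  have hl₁ : ∀ᵐ z ∂volume, Tendsto (fun k => F₁ k z) atTop (𝓝 (f₁ z)) :=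
    Eventually.of_forall fun z => by
      have hg : Tendsto (fun k => gradSq (Uk k) z) atTop (𝓝 (gradSq U z)) := by
        simp only [gradSq]
        exact tendsto_finsetSum _ fun i _ => ((limdx i z).norm).pow 2
      exact ((((limU z).norm).pow 2).const_mul (w₁ z)).add (hg.const_mul (w₂ z))
  have hl₂ : ∀ᵐ z ∂volume, Tendsto (fun k => F₂ k z) atTop (𝓝 (f₂ z)) :=
    Eventually.of_forall fun z => (((limPL z).norm).pow 2).const_mul (w₃ z)
  have hI := tendsto_integral_of_dominated_convergence _ (fun k => (cF₁ k).aestronglyMeasurable) ib₁ hb₁ hl₁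
  have hJ := tendsto_integral_of_dominated_convergence _ (fun k => (cF₂ k).aestronglyMeasurable) ib₂ hb₂ hl₂
  exact le_of_tendsto_of_tendsto' hI (hJ.const_mul C) fun k => Hk k

end Mollify


section C2Corollaries

variable {E : Type*} [NormedAddCommGroup E] [InnerProductSpace ℝ E] [FiniteDimensional ℝ E]
  [MeasurableSpace E] [BorelSpace E]
variable {F : Type*} [NormedAddCommGroup F] [InnerProductSpace ℝ F] [CompleteSpace F]

/-- **The first Carleman inequality (Seregin 2014, Prop. 1.2, (A.1.1)) for `C²` data**:
`carleman_inequality_first` extends from `C_c^∞` to `u ∈ C²` with compact support in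
`]0, 2[ × E` (as used in the proofs of Lemmas A.1–A.2, where `u` is a cut-off of a rescaled
`C²`/`W^{2,1}_2` function). [cite: Seregin2014, App. A.1 Prop. 1.2 (A.1.1)] -/
theorem carleman_inequality_first_of_contDiff_two {a : ℝ} (ha : 0 < a) {U : ℝ × E → F}
    (hU : ContDiff ℝ 2 U) (hUc : HasCompactSupport U)
    (hUs : tsupport U ⊆ Ioo (0 : ℝ) 2 ×ˢ (univ : Set E)) :
    ∫ z, carlemanWeight a z * (a / z.1 * ‖U z‖ ^ 2 + gradSq U z) ≤
      11 * Real.exp (4 / 3) * ∫ z, carlemanWeight a z * ‖dt U z + lap U z‖ ^ 2 := by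
  set O : Set (ℝ × E) := Ioo (0 : ℝ) 2 ×ˢ (univ : Set E) with hO
  have hOo : IsOpen O := (isOpen_Ioo.prod isOpen_univ)
  have cw : ContinuousOn (carlemanWeight a : ℝ × E → ℝ) O := fun z hz =>
    ((continuousOn_carlemanWeight a hz.1.1).continuousAt
      ((isOpen_lt continuous_const continuous_fst).mem_nhds (by
        show z.1 / 2 < z.1; linarith [hz.1.1]))).continuousWithinAt
  have cw₁ : ContinuousOn (fun z : ℝ × E => carlemanWeight a z * (a / z.1)) O :=
    cw.mul (continuousOn_const.div continuous_fst.continuousOn fun z hz => hz.1.1.ne')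
  have e : ∀ V : ℝ × E → F, (fun z => carlemanWeight a z * (a / z.1 * ‖V z‖ ^ 2 + gradSq V z)) =
      fun z => carlemanWeight a z * (a / z.1) * ‖V z‖ ^ 2 + carlemanWeight a z * gradSq V z := by
    intro V; funext z; ring
  have H : ∀ V : ℝ × E → F, ContDiff ℝ (⊤ : ℕ∞) V → HasCompactSupport V → tsupport V ⊆ O →
      ∫ z, (carlemanWeight a z * (a / z.1) * ‖V z‖ ^ 2 + carlemanWeight a z * gradSq V z) ≤
        11 * Real.exp (4 / 3) * ∫ z, carlemanWeight a z * ‖dt V z + lap V z‖ ^ 2 := by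
    intro V hV hVc hVs
    have h := carleman_inequality_first hV hVc hVs ha
    rwa [e V] at h
  have h := weightedIneq_of_smooth hOo cw₁ cw cw H hU hUc hUs
  rwa [e U]

/-- **The second Carleman inequality (Seregin 2014, Prop. 1.3, (A.1.12)) for `C²` data**:
`carleman_inequality_second` extends from `C_c^∞` to `u ∈ C²` with compact support in
`]0, 1[ × {⟪x, eₙ⟫ > 1}` (as used in the proof of Lemma A.3). [cite: Seregin2014, App. A.1 Prop. 1.3 (A.1.12)] -/
theorem carleman_inequality_second_of_contDiff_two {α a : ℝ} (hα : 1 / 2 < α) (hα1 : α < 1)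
    (ha : 2 ≤ a) {en : E} (hen : ‖en‖ = 1) {U : ℝ × E → F} (hU : ContDiff ℝ 2 U)
    (hUc : HasCompactSupport U) (hUs : tsupport U ⊆ Ioo (0 : ℝ) 1 ×ˢ {x : E | 1 < ⟪x, en⟫}) :
    ∫ z, z.1 ^ 2 * Real.exp (2 * phiKR a (kA α) (rhoA α) en z) *
        (a * ‖U z‖ ^ 2 / z.1 ^ 2 + gradSq U z / z.1) ≤
      (5 + 3 / (2 * α - 1)) *
        ∫ z, z.1 ^ 2 * Real.exp (2 * phiKR a (kA α) (rhoA α) en z) * ‖dt U z + lap U z‖ ^ 2 := by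
  set O : Set (ℝ × E) := Ioo (0 : ℝ) 1 ×ˢ {x : E | 1 < ⟪x, en⟫} with hO
  have hOo : IsOpen O := isOpen_Ioo.prod (isOpen_lt continuous_const (continuous_id.inner continuous_const))
  have hOΩ : O ⊆ halfDom en := fun z hz => ⟨hz.1.1, lt_trans zero_lt_one hz.2⟩
  set w : ℝ × E → ℝ := fun z => z.1 ^ 2 * Real.exp (2 * phiKR a (kA α) (rhoA α) en z) with hw
  have cφ : ContinuousOn (phiKR a (kA α) (rhoA α) en) O :=
    (contDiffOn_phiKR (contDiffOn_kA α) (contDiffOn_rhoA α) a en).continuousOn.mono hOΩ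
  have cw : ContinuousOn w O := (continuous_fst.pow 2).continuousOn.mul (continuousOn_const.mul cφ).rexp
  have ct0 : ∀ z ∈ O, z.1 ≠ 0 := fun z hz => hz.1.1.ne'
  have cw₁ : ContinuousOn (fun z => w z * (a / z.1 ^ 2)) O :=
    cw.mul (continuousOn_const.div (continuous_fst.pow 2).continuousOn fun z hz => pow_ne_zero _ (ct0 z hz))
  have cw₂ : ContinuousOn (fun z => w z * (1 / z.1)) O :=
    cw.mul (continuousOn_const.div continuous_fst.continuousOn ct0)
  have e : ∀ V : ℝ × E → F, (fun z => z.1 ^ 2 * Real.exp (2 * phiKR a (kA α) (rhoA α) en z) *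
      (a * ‖V z‖ ^ 2 / z.1 ^ 2 + gradSq V z / z.1)) =
      fun z => w z * (a / z.1 ^ 2) * ‖V z‖ ^ 2 + w z * (1 / z.1) * gradSq V z := by
    intro V; funext z; simp only [hw]; ring
  have H : ∀ V : ℝ × E → F, ContDiff ℝ (⊤ : ℕ∞) V → HasCompactSupport V → tsupport V ⊆ O →
      ∫ z, (w z * (a / z.1 ^ 2) * ‖V z‖ ^ 2 + w z * (1 / z.1) * gradSq V z) ≤
        (5 + 3 / (2 * α - 1)) * ∫ z, w z * ‖dt V z + lap V z‖ ^ 2 := by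
    intro V hV hVc hVs
    have h := carleman_inequality_second hα hα1 ha hen hV hVc hVs
    rwa [e V] at h
  have h := weightedIneq_of_smooth hOo cw₁ cw₂ cw H hU hUc hUs
  rwa [e U]

end C2Corollaries

end Carleman

end Literature.Analysis.FluidPDE
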